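import Summits.BirchSwinnertonDyer.Rank1Residual.X11a.ChainNamedFacts
import HarnessLib

/-!
# Class X11a, surjective leaf, `p ≥ 5`: the chain on the PRINT-FAITHFUL (BOUNDED) Wan / EPW facts
# (2026-08-20 repair of a mis-quantification; cell `b2b-bsdres`, units `lit-su` / `harvest-2`)

HONEST FRAMING (run/shared/lean/b2b/bsd-rank1-residual/, verbatim in every file): the goal of the
cell is to DELETE the COMBINATION-SHAPED residual classes of the Birch–Swinnerton-Dyer formula for
ALL analytic-rank `≤ 1` elliptic curves over `ℚ` — "full BSD formula for every rank `≤ 1` curve in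
class `C`" assembled STRICTLY from published theorems — so that the rank-`≤ 1` remainder becomes
exactly the CONSTRUCTION-SHAPED classes, which are TYPED (missing-input `Prop`s), NOT attempted.
This is not "finishing BSD". Research route; NO CLAIM BEYOND STATED CLASSES. Theorems only; every
published input is an explicit NAMED-FACT hypothesis; no new definition, no new fact.

WHY THIS FILE. The chain of record (`X11a/ChainDischarge.lean`: `Chain.invariantsAt_normLam_of_facts`,
`Chain.bsdp_of_facts`, `X11a.forall_bsdp_of_facts`; `X11a/ChainNamedFacts.lean`:
`X11a.forall_bsdp_of_namedFacts`, p206662) takes as binders the named facts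
`Wan2015.thm4_rational_weightK_member` (Wan 2015 Thm. 4, rational part) and
`EmertonPollackWeston2006.thm513_transfer_from_weightK_member` (EPW 2006 Thm. 5.1.3), both of which
quantify over EVERY series `L : ℚ̄_p⟦T⟧` satisfying the bare interpolation predicate
`IsCycPAdicLFunctionWeightK g Dsym p ι υ L` (constant term + values at `ζ − 1`, `ζ ≠ 1` of
`p`-power order). That predicate does not determine `L`: it is preserved by `L ↦ L + log(1 + T)`
(`log(1+T)` has zero constant term and `log_p ζ = 0`), an UNBOUNDED modification, whereas the Wan
fact concludes the bounded shape `L = c · (u · G)`; so `thm4_rational_weightK_member` is FALSE as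
typed as soon as its data are instantiated with a genuine `p`-adic `L`-function — which the chain
does, through `exists_isCycPAdicLFunctionWeightK`, DISCARDING that fact's boundedness clause
(`obtain ⟨L, hL, -, -⟩`). The original chain theorems therefore hold vacuously in `hT2` (finding
of the cell's `lit-su` seat, SU2014-TYPING.md §5/§8; verified independently by the harvest-2 seat).
In print there is no gap: Wan's `𝓛_f` is THE Manin–Višik `p`-adic `L`-function, an element of
`Λ_{ℚ,𝒪_L}` ("`L ⊂ ℚ̄_p` a finite extension of `ℚ_p`"), i.e. the BOUNDED interpolant (unique among
bounded series). The corrected facts `Wan2015.thm4_rational_weightK_member_of_bdd` (p239712) and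
`EmertonPollackWeston2006.thm513_transfer_from_weightK_member_of_bdd` (p239784) carry exactly one
more binder, `∃ C, ∀ i, ‖coeff_i L‖ ≤ C`, which `exists_isCycPAdicLFunctionWeightK` delivers.

THIS FILE re-runs the chain on the corrected facts: the SAME proofs with the boundedness clause kept
and fed to `hT2`/`hT1b` — `Chain.invariantsAt_normLam_of_facts_bdd`, `Chain.bsdp_of_facts_bdd`,
`X11a.forall_bsdp_of_facts_bdd`, `X11a.forall_bsdp_of_namedFacts_bdd` (hypotheses WEAKER than the
originals': the corrected facts are implied by the unrestricted ones,
`Wan2015.thm4_rational_weightK_member_of_bdd.of_unrestricted` /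
`thm513_transfer_from_weightK_member_of_bdd.of_unrestricted`). The gate's append-only rule
("deprecate, don't mutate") keeps the originals in place; they are DEPRECATED and are to be removed,
with the two retired facts, once no file references them (the threaders `ChainNotDvd`,
`ChainLargePrime`, `ChainMTT`, `ChainHeightFree`, `ChainBySplitType` migrate the same way). RESULT
(`X11a.forall_bsdp_of_namedFacts_bdd`): on X11a ∩ {`p ≥ 5`, `ρ̄_{E,p}` surjective},
`MuAnZeroAt W p ⟹ BSD(E,p)` from named PUBLISHED facts only (Hida member; Mazur–Tate–Teitelbaum;
EPW Thm 3.1.1 / Thm 1 / Thm 5.1.3 (bounded); Wan Thm 4 rational (bounded); Deligne–Serre 6.1;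
Hida/Wiles 3.26; Kato–Wuthrich A32; Stein–Wuthrich Thm 6.1 + heights; Greenberg–Stevens; GZK;
modularity) plus ONE finite certificate per pair; class-level residue = Greenberg's `μ`-conjecture
(OPEN, NAMED, typed `X11a.MuAnZeroAt`). No label change by this file (cell lead / referee).

References: [Wan2015] Thm. 4 (pp. 4–5) = Thm. 103 (pp. 91–92); [EmertonPollackWeston2006] Thm. 1,
3.1.1, 4.4.5, 5.1.3; [MazurTateTeitelbaum1986] §I.11, §I.14; [SkinnerUrban2014] §3.4.4;
HOME/b2b-bsdres-lit-su/SU2014-TYPING.md §5, §8; HOME/b2b-bsdres-x11a/X11A-CHAIN.md.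
-/

noncomputable section

open scoped Classical MatrixGroups ModularForm

open CongruenceSubgroup WeierstrassCurve Literature.NumberTheory.EllipticCurves
  Literature.NumberTheory.EllipticCurves.ModularForms
  Literature.NumberTheory.EllipticCurves.Rank1Residual
  Literature.NumberTheory.EllipticCurves.Rank1Residual.Typed
  Literature.NumberTheory.EllipticCurves.Wuthrich2014
  Literature.NumberTheory.EllipticCurves.SteinWuthrich2013
  Literature.NumberTheory.EllipticCurves.GreenbergVatsal2000
  Literature.NumberTheory.EllipticCurves.EmertonPollackWeston2006
  Summit.BirchSwinnertonDyer.Rank1Residual.X1.MuLambda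
  Summit.BirchSwinnertonDyer.Rank1Residual.X11a.LambdaNorm

set_option autoImplicit false

namespace Summit.BirchSwinnertonDyer.Rank1Residual.X11a.Chain

/-! ### The discharge on the bounded facts -/

section DischargeBdd

variable (W : WeierstrassCurve ℚ) [W.IsElliptic] [W.IsGloballyMinimal] (p : ℕ) [Fact p.Prime]

/-- **The chain at a pair, from the separate published facts — on the print-faithful (BOUNDED)
Wan / EPW facts** (successor of `Chain.invariantsAt_normLam_of_facts`, same proof with the
boundedness clause of `exists_isCycPAdicLFunctionWeightK` kept and fed to `hT2`/`hT1b`). Hypotheses: the named facts listed in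
the module docstring; the existence inputs (E1) `hData`, (E2) `hDual`, (E3) `hGen` (displayed); a
multiplicative `p ≥ 5` with `ρ̄_{E,p}` surjective and the certificate `MuAnZeroAt W p`. Conclusion:
every Kato pair has unit contents and `normLam gK = normLam fE`.
[cite: EmertonPollackWeston2006, Thm. 1, Thm. 3.1.1, Thm. 5.1.3] [cite: Wan2015, Thm. 4] -/
theorem invariantsAt_normLam_of_facts_bdd [NeZero (W.conductorNorm ℤ / p)]
    (hHida : hida_exists_congruent_ordinary_newform_of_multiplicative)
    (hMTT : exists_isCycPAdicLFunctionWeightK)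
    (h311 : thm311_cotorsion_weightK_member) (hT1a : thm1_muAlg_of_weightK_member)
    (hT2 : Wan2015.thm4_rational_weightK_member_of_bdd)
    (hT1b : thm513_transfer_from_weightK_member_of_bdd)
    (hKato : kato_charIdeal_dvd_multiplicative_of_surjective)
    (hpar : nonempty_modularParametrizationData)
    (hData : ∀ {k : ℤ} (g : CuspForm (Gamma0 (W.conductorNorm ℤ / p)) k)
      (ι : coeffField g →+* PadicAlgCl p), IsOrdinaryMemberOf W p g ι →
      Nonempty (OrdinaryPadicData g p ι))
    (hDual : ∀ {k : ℤ} (g : CuspForm (Gamma0 (W.conductorNorm ℤ / p)) k)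
      (ι : coeffField g →+* PadicAlgCl p), IsOrdinaryMemberOf W p g ι →
      ∀ (𝔇 : OrdinaryPadicData g p ι) (κ : ZpExtension ℚ p)
      (γ : Field.absoluteGaloisGroup ℚ), κ.IsCyclotomic → κ.IsTopGenerator γ →
      Nonempty (GreenbergSelmer.DualData (padicCoeffField (memberGenerators g ι 𝔇.υ)) κ γ 𝔇.ρ 𝔇.plus))
    (hGen : ∀ {k : ℤ} (g : CuspForm (Gamma0 (W.conductorNorm ℤ / p)) k)
      (ι : coeffField g →+* PadicAlgCl p), IsOrdinaryMemberOf W p g ι →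
      ∀ (𝔇 : OrdinaryPadicData g p ι) (κ : ZpExtension ℚ p)
      (γ : Field.absoluteGaloisGroup ℚ), κ.IsCyclotomic → κ.IsTopGenerator γ →
      ∀ (D : GreenbergSelmer.DualData (padicCoeffField (memberGenerators g ι 𝔇.υ)) κ γ 𝔇.ρ 𝔇.plus),
      Module.Finite (PowerSeries (padicCoeffIntegers (memberGenerators g ι 𝔇.υ))) D.X →
      Module.IsTorsion (PowerSeries (padicCoeffIntegers (memberGenerators g ι 𝔇.υ))) D.X →
      ∃ G, D.charIdeal = Ideal.span {G})
    (hp : 5 ≤ p) (hmult : W.HasMultiplicativeReductionAtPrime p)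
    (hsurj : W.HasSurjectiveModNGaloisRep p) (hμ : MuAnZeroAt W p) :
    InvariantsAt W p fun gK fE => HasUnitContent gK ∧ HasUnitContent fE ∧ normLam gK = normLam fE := by
  have hprime : p.Prime := Fact.out
  have hp2 : p ≠ 2 := by omega
  haveI : NeZero p := ⟨hprime.ne_zero⟩
  have hirr : W.HasIrreducibleModPGaloisRep p :=
    hasIrreducibleModPGaloisRep_of_hasSurjectiveModNGaloisRep W p hsurj
  have hpM : ¬ p ∣ W.conductorNorm ℤ / p := not_dvd_conductorNorm_div W p hmult
  -- [L1]: the weight-`k` member, `k = (p − 1) + 2`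
  set n : ℕ := p - 1 with hn
  have hn0 : n ≠ 0 := by omega
  have hneven : Even n := hn ▸ hprime.even_sub_one hp2
  have hk2 : (2 : ℤ) < (n : ℤ) + 2 := by omega
  have hkdvd : ((p : ℤ) - 1) ∣ ((n : ℤ) + 2 - 2) := by
    refine ⟨1, ?_⟩
    rw [hn, Nat.cast_sub hprime.one_le]; push_cast; ring
  obtain ⟨g, ι, hg, hap, hcong⟩ := hHida W p hp hmult inferInstance ((n : ℤ) + 2) hk2 hkdvd
  have hmem : IsOrdinaryMemberOf W p g ι := ⟨hk2, hkdvd, hg, hap, hcong⟩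
  -- (E1) the ordinary `p`-adic data; Shimura's datum; THE `p`-adic `L`-function
  obtain ⟨𝔇⟩ := hData g ι hmem
  obtain ⟨Dsym⟩ := IsNewform0.nonempty_periodSymbolDatum hneven hn0 hg
  -- keep the BOUNDEDNESS clause of the MTT fact: the uniqueness class of THE `p`-adic `L`-function,
  -- the extra binder of the corrected facts `…_of_bdd` (the original proof discarded it)
  obtain ⟨L, hL, hbd, -⟩ := hMTT g hg (by omega) p hpM ι 𝔇.υ 𝔇.υ_root 𝔇.norm_υ Dsym
  -- [L4]: `μ(X(E/ℚ_∞)) = 0` for every cyclotomic / dual datum, from the certificate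
  have hμalg : ∀ (κ : ZpExtension ℚ p) (γ : Field.absoluteGaloisGroup ℚ), κ.IsCyclotomic →
      κ.IsTopGenerator γ → IsCyclotomicVariable p γ →
      ∀ D' : W.SelmerDualData κ γ, D'.IsTorsion ∧ D'.mu = 0 :=
    fun κ γ hκ hγ hγ' D' =>
      ⟨(isTorsion_and_exists_generator_hasUnitContent_of_muAnZeroAt W p hKato hpar hp hmult hsurj hμ
          hκ hγ hγ' D').1,
        selmerDual_mu_eq_zero_of_muAnZeroAt W p hKato hpar hp hmult hsurj hμ hκ hγ hγ' D'⟩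
  -- the conclusion's own cyclotomic datum serves the `g`-side
  intro κ γ hκ hγ hγ' N _ f hf D' ϖ hϖ fE gK hchar
  obtain ⟨D⟩ := hDual g ι hmem 𝔇 κ γ hκ hγ
  obtain ⟨hfin, htors⟩ := h311 W p hp hmult hirr g ι hmem 𝔇 κ γ hκ hγ D
  obtain ⟨G, hG⟩ := hGen g ι hmem 𝔇 κ γ hκ hγ D hfin htors
  -- EPW Thm. 1 (alg): `μ^alg(g) = 0`
  have hμg := hT1a W p hp hmult hirr hμalg g ι hmem 𝔇 κ γ hκ hγ hγ' D htors G hG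
  -- Wan Thm. 4: `L = c · u · G`, hence `λ^alg(g) = λ^an(g)`
  obtain ⟨c, u, hc, hLcuG⟩ :=
    hT2 W p hp hmult hsurj hpM g ι hmem 𝔇 κ γ hκ hγ hγ' D htors G hG Dsym L hL hbd
  have hlam : normLam (PowerSeries.map (padicCoeffIntegers (memberGenerators g ι 𝔇.υ)).subtype G) =
      normLam L := by
    obtain ⟨hU0, hU⟩ := map_unit_integral u
    obtain ⟨hGmax, hG0⟩ := hasMaxCoeff_map_of_exists_norm_eq_one hμg
    rw [hLcuG, normLam_C_mul (norm_ne_zero_iff.mpr hc), map_mul,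
      normLam_mul_of_integral_unit hU0 hU hGmax hG0]
  -- EPW Thm. 5.1.3 (+ 4.4.5 with the certificate), at the Kato pair
  exact hT1b W p hp hmult hirr g ι hmem 𝔇 κ γ hκ hγ hγ' D htors G hG Dsym L hL hbd hμg hlam hμ κ γ hκ
    hγ hγ' f hf D' ϖ hϖ fE gK hchar

/-- **`BSD(E,p)` at a pair of X11a's surjective leaf, from the separate published facts — on the
print-faithful (BOUNDED) Wan / EPW facts** (successor of `Chain.bsdp_of_facts`)
(`r_an = 0`; socket `bsdp_of_invariantsAt_normLam`). [cite: EmertonPollackWeston2006, Thm. 5.1.3]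
[cite: Wan2015, Thm. 4] [cite: SteinWuthrich2013, Thm. 6.1 (p. 20)] -/
theorem bsdp_of_facts_bdd [NeZero (W.conductorNorm ℤ / p)]
    (hHida : hida_exists_congruent_ordinary_newform_of_multiplicative)
    (hMTT : exists_isCycPAdicLFunctionWeightK)
    (h311 : thm311_cotorsion_weightK_member) (hT1a : thm1_muAlg_of_weightK_member)
    (hT2 : Wan2015.thm4_rational_weightK_member_of_bdd)
    (hT1b : thm513_transfer_from_weightK_member_of_bdd)
    (hKato : kato_charIdeal_dvd_multiplicative_of_surjective)
    (hJs : thm61_splitMultiplicative) (hJn : thm61_nonsplitMultiplicative)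
    (hHs : exists_isSplitMultCanonical) (hHn : exists_isMultCanonical)
    (hGZK : rank_eq_analyticRank_of_analyticRank_le_one) (hmod : hasEntireLFunction_rat)
    (hpar : nonempty_modularParametrizationData)
    (hGS : greenberg_stevens (W := W) (p := p))
    (hData : ∀ {k : ℤ} (g : CuspForm (Gamma0 (W.conductorNorm ℤ / p)) k)
      (ι : coeffField g →+* PadicAlgCl p), IsOrdinaryMemberOf W p g ι →
      Nonempty (OrdinaryPadicData g p ι))
    (hDual : ∀ {k : ℤ} (g : CuspForm (Gamma0 (W.conductorNorm ℤ / p)) k)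
      (ι : coeffField g →+* PadicAlgCl p), IsOrdinaryMemberOf W p g ι →
      ∀ (𝔇 : OrdinaryPadicData g p ι) (κ : ZpExtension ℚ p)
      (γ : Field.absoluteGaloisGroup ℚ), κ.IsCyclotomic → κ.IsTopGenerator γ →
      Nonempty (GreenbergSelmer.DualData (padicCoeffField (memberGenerators g ι 𝔇.υ)) κ γ 𝔇.ρ 𝔇.plus))
    (hGen : ∀ {k : ℤ} (g : CuspForm (Gamma0 (W.conductorNorm ℤ / p)) k)
      (ι : coeffField g →+* PadicAlgCl p), IsOrdinaryMemberOf W p g ι →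
      ∀ (𝔇 : OrdinaryPadicData g p ι) (κ : ZpExtension ℚ p)
      (γ : Field.absoluteGaloisGroup ℚ), κ.IsCyclotomic → κ.IsTopGenerator γ →
      ∀ (D : GreenbergSelmer.DualData (padicCoeffField (memberGenerators g ι 𝔇.υ)) κ γ 𝔇.ρ 𝔇.plus),
      Module.Finite (PowerSeries (padicCoeffIntegers (memberGenerators g ι 𝔇.υ))) D.X →
      Module.IsTorsion (PowerSeries (padicCoeffIntegers (memberGenerators g ι 𝔇.υ))) D.X →
      ∃ G, D.charIdeal = Ideal.span {G})
    (hp : 5 ≤ p) (hmult : W.HasMultiplicativeReductionAtPrime p)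
    (hsurj : W.HasSurjectiveModNGaloisRep p) (hr : W.analyticRank = 0) (hμ : MuAnZeroAt W p) :
    BSDp W p :=
  bsdp_of_invariantsAt_normLam W p hKato hJs hJn hHs hHn hGZK hmod hpar hGS hp hmult hsurj hr
    (invariantsAt_normLam_of_facts_bdd W p hHida hMTT h311 hT1a hT2 hT1b hKato hpar hData hDual hGen
      hp hmult hsurj hμ)

end DischargeBdd

end Summit.BirchSwinnertonDyer.Rank1Residual.X11a.Chain

/-! ### Class level -/

namespace Summit.BirchSwinnertonDyer.Rank1Residual.X11a

open Chain

/-- **X11a ∩ {`p ≥ 5`, `ρ̄_{E,p}` surjective}: `BSD(E,p)` ⇐ PUBLISHED facts + existence of the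
`p`-adic data (E1)–(E3) + the per-pair certificate `μ^an(E,p) = 0` — on the print-faithful
(BOUNDED) Wan / EPW facts** (successor of `X11a.forall_bsdp_of_facts`) — the published facts being
Hida's member, Mazur–Tate–Teitelbaum, EPW 2006 Thm 1 / 3.1.1 / 5.1.3 (+4.4.5), Wan 2015 Thm 4
(rational), Kato–Wuthrich A32, Stein–Wuthrich Thm 6.1 + heights, Greenberg–Stevens, GZK, modularity
(all NAMED facts, explicit), and (E1)–(E3) displayed (Deligne + Wiles data; Pontryagin dual;
principal generator). Class-level residue: Greenberg's `μ`-conjecture (typed: `X11a.MuAnZeroAt`).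
No label change is made by this theorem (the cell lead / referee decide; flags on the facts:
`Wan15-Thm103-Fujiwara`, `EPW-canonical-period`). [cite: EmertonPollackWeston2006, Thm. 1, Thm. 5.1.3]
[cite: Wan2015, Thm. 4] [cite: SteinWuthrich2013, Thm. 6.1 (p. 20)] -/
theorem forall_bsdp_of_facts_bdd
    (hHida : hida_exists_congruent_ordinary_newform_of_multiplicative)
    (hMTT : exists_isCycPAdicLFunctionWeightK)
    (h311 : thm311_cotorsion_weightK_member) (hT1a : thm1_muAlg_of_weightK_member)
    (hT2 : Wan2015.thm4_rational_weightK_member_of_bdd)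
    (hT1b : thm513_transfer_from_weightK_member_of_bdd)
    (hKato : kato_charIdeal_dvd_multiplicative_of_surjective)
    (hJs : thm61_splitMultiplicative) (hJn : thm61_nonsplitMultiplicative)
    (hHs : exists_isSplitMultCanonical) (hHn : exists_isMultCanonical)
    (hGZK : rank_eq_analyticRank_of_analyticRank_le_one) (hmod : hasEntireLFunction_rat)
    (hpar : nonempty_modularParametrizationData)
    (hGS : ∀ (W : WeierstrassCurve ℚ) [W.IsElliptic] [W.IsGloballyMinimal] (p : ℕ) [Fact p.Prime],
      greenberg_stevens (W := W) (p := p))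
    (hData : ∀ (W : WeierstrassCurve ℚ) [W.IsElliptic] [W.IsGloballyMinimal] (p : ℕ) [Fact p.Prime]
      [NeZero (W.conductorNorm ℤ / p)] {k : ℤ} (g : CuspForm (Gamma0 (W.conductorNorm ℤ / p)) k)
      (ι : coeffField g →+* PadicAlgCl p), IsOrdinaryMemberOf W p g ι →
      Nonempty (OrdinaryPadicData g p ι))
    (hDual : ∀ (W : WeierstrassCurve ℚ) [W.IsElliptic] [W.IsGloballyMinimal] (p : ℕ) [Fact p.Prime]
      [NeZero (W.conductorNorm ℤ / p)] {k : ℤ} (g : CuspForm (Gamma0 (W.conductorNorm ℤ / p)) k)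
      (ι : coeffField g →+* PadicAlgCl p), IsOrdinaryMemberOf W p g ι →
      ∀ (𝔇 : OrdinaryPadicData g p ι) (κ : ZpExtension ℚ p)
      (γ : Field.absoluteGaloisGroup ℚ), κ.IsCyclotomic → κ.IsTopGenerator γ →
      Nonempty (GreenbergSelmer.DualData (padicCoeffField (memberGenerators g ι 𝔇.υ)) κ γ 𝔇.ρ 𝔇.plus))
    (hGen : ∀ (W : WeierstrassCurve ℚ) [W.IsElliptic] [W.IsGloballyMinimal] (p : ℕ) [Fact p.Prime]
      [NeZero (W.conductorNorm ℤ / p)] {k : ℤ} (g : CuspForm (Gamma0 (W.conductorNorm ℤ / p)) k)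
      (ι : coeffField g →+* PadicAlgCl p), IsOrdinaryMemberOf W p g ι →
      ∀ (𝔇 : OrdinaryPadicData g p ι) (κ : ZpExtension ℚ p)
      (γ : Field.absoluteGaloisGroup ℚ), κ.IsCyclotomic → κ.IsTopGenerator γ →
      ∀ (D : GreenbergSelmer.DualData (padicCoeffField (memberGenerators g ι 𝔇.υ)) κ γ 𝔇.ρ 𝔇.plus),
      Module.Finite (PowerSeries (padicCoeffIntegers (memberGenerators g ι 𝔇.υ))) D.X →
      Module.IsTorsion (PowerSeries (padicCoeffIntegers (memberGenerators g ι 𝔇.υ))) D.X →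
      ∃ G, D.charIdeal = Ideal.span {G}) :
    ∀ (W : WeierstrassCurve ℚ) [W.IsElliptic] [W.IsGloballyMinimal] (p : ℕ) [Fact p.Prime],
      ClassX11a W p → 5 ≤ p → Surj W p → MuAnZeroAt W p → BSDp W p := by
  intro W _ _ p _ hX hp hsurj hμ
  haveI : NeZero (W.conductorNorm ℤ / p) := neZero_conductorNorm_div W p hX.2.2.1
  exact bsdp_of_facts_bdd W p hHida hMTT h311 hT1a hT2 hT1b hKato hJs hJn hHs hHn hGZK hmod hpar
    (hGS W p)
    (hData W p) (hDual W p) (hGen W p) hp hX.2.2.1 hsurj hX.1 hμ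

/-- **X11a ∩ {`p ≥ 5`, `ρ̄_{E,p}` surjective}: `BSD(E,p)` ⇐ NAMED PUBLISHED FACTS + the per-pair
certificate `μ^an(E,p) = 0` — no displayed hypothesis; on the print-faithful (BOUNDED) Wan / EPW
facts** (successor of `X11a.forall_bsdp_of_namedFacts`, p206662). The existence inputs (E1)–(E3) are
THEOREMS: `exists_ordinaryPadicData_weightK_member_of_thm61_of_thm326` (EPW §3.1 / Deligne /
Wiles 88 Thm 2.2; granted the named facts `DeligneSerre1974.thm61_exists_adicGaloisRep` and
`Hida2000_thm326_ordinary`, harvest-2 p205893), `GreenbergSelmer.exists_dualData_weightK_member_unconditional`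
(EPW §3.1 / Greenberg 1989 §1; harvest-2 p206456) and `charIdeal_isPrincipal_weightK_member_unconditional`
(structure theory over `𝒪⟦T⟧`, Washington §13.2; harvest-2 p206115). Every other binder is a named published fact
(Hida member, MTT, EPW Thm 3.1.1 / Thm 1 / Thm 5.1.3, Wan Thm 4, Kato–Wuthrich A32, Stein–Wuthrich
Thm 6.1 + heights, Greenberg–Stevens, GZK, modularity). In words: on X11a's surjective leaf at
`p ≥ 5`, the `p`-part of BSD follows from the published record plus ONE finite certificate per pair
(`X11a.MuAnZeroAt`: the Néron-normalised Mazur–Tate–Teitelbaum series has a unit coefficient) —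
the class-level residue being Greenberg's `μ`-conjecture for irreducible `E[p]` (OPEN, NAMED,
typed). No label change is made by this theorem (cell lead / referee; informational flags on the
facts: `Wan15-Thm103-Fujiwara`, `EPW-canonical-period`, Greenberg-vs-classical Selmer).
[cite: EmertonPollackWeston2006, Thm. 1, Thm. 3.1.1, Thm. 5.1.3, §3.1] [cite: Wan2015, Thm. 4]
[cite: SteinWuthrich2013, Thm. 6.1 (p. 20)] [cite: Wuthrich2014, Thm. 3 (p. 382) and Cor. 19 proof (p. 399)] -/
theorem forall_bsdp_of_namedFacts_bdd
    (hHida : hida_exists_congruent_ordinary_newform_of_multiplicative)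
    (hMTT : exists_isCycPAdicLFunctionWeightK)
    (h311 : thm311_cotorsion_weightK_member) (hT1a : thm1_muAlg_of_weightK_member)
    (hT2 : Wan2015.thm4_rational_weightK_member_of_bdd)
    (hT1b : thm513_transfer_from_weightK_member_of_bdd)
    (h61 : DeligneSerre1974.thm61_exists_adicGaloisRep) (h326 : Hida2000_thm326_ordinary)
    (hKato : kato_charIdeal_dvd_multiplicative_of_surjective)
    (hJs : thm61_splitMultiplicative) (hJn : thm61_nonsplitMultiplicative)
    (hHs : exists_isSplitMultCanonical) (hHn : exists_isMultCanonical)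
    (hGZK : rank_eq_analyticRank_of_analyticRank_le_one) (hmod : hasEntireLFunction_rat)
    (hpar : nonempty_modularParametrizationData)
    (hGS : ∀ (W : WeierstrassCurve ℚ) [W.IsElliptic] [W.IsGloballyMinimal] (p : ℕ) [Fact p.Prime],
      greenberg_stevens (W := W) (p := p)) :
    ∀ (W : WeierstrassCurve ℚ) [W.IsElliptic] [W.IsGloballyMinimal] (p : ℕ) [Fact p.Prime],
      ClassX11a W p → 5 ≤ p → Surj W p → MuAnZeroAt W p → BSDp W p := by
  intro W _ _ p _ hX hp hsurj hμ
  haveI : NeZero (W.conductorNorm ℤ / p) := neZero_conductorNorm_div W p hX.2.2.1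
  haveI : NeZero p := ⟨(Fact.out : p.Prime).ne_zero⟩
  have hmult : W.HasMultiplicativeReductionAtPrime p := hX.2.2.1
  have hirr : W.HasIrreducibleModPGaloisRep p :=
    hasIrreducibleModPGaloisRep_of_hasSurjectiveModNGaloisRep W p hsurj
  exact bsdp_of_facts_bdd W p hHida hMTT h311 hT1a hT2 hT1b hKato hJs hJn hHs hHn hGZK hmod hpar
    (hGS W p)
    (fun g ι hmem =>
      exists_ordinaryPadicData_weightK_member_of_thm61_of_thm326 h61 h326 W p hp hmult hirr g ι hmem)
    (fun g ι hmem 𝔇 κ γ hκ hγ =>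
      GreenbergSelmer.exists_dualData_weightK_member_unconditional W p hp hmult hirr g ι hmem 𝔇 κ γ
        hκ hγ)
    (fun g ι hmem 𝔇 κ γ hκ hγ D hfin htors =>
      (charIdeal_isPrincipal_weightK_member_unconditional W p hp hmult hirr g ι hmem 𝔇 κ γ hκ hγ D
        hfin htors).principal)
    hp hmult hsurj hX.1 hμ

end Summit.BirchSwinnertonDyer.Rank1Residual.X11a

end
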